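import Summits.CriticalPhenomena.SAWScalingLimit.Theses.SAWRenewalTightness
import Summits.CriticalPhenomena.SAWScalingLimit.Theorems.SubseqIdentification.Negative.ProbabilityRedundant
import Summits.CriticalPhenomena.SAWScalingLimit.Theorems.SubseqIdentification.Negative.CompactContainerZd
import Summits.CriticalPhenomena.SAWScalingLimit.Theorems.ObservableToSLE.Negative.CompactContainer
import Literature.Probability.RandomPlanarGeometry.LocalMartingaleProofs

/-!
# `EventualTight` — negative knowledge: tightness is NECESSARY for the summit conjunct

Support file for the crux `stmt-CriticalPhenomena-1372`
(`Summit.CriticalPhenomena.SAWScalingLimit.Theses.SAWRenewalTightness.EventualTight`; refuter `cdisprove`;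
work file `Summits/CriticalPhenomena/SAWScalingLimit/Cruxes/EventualTight/Disproof.lean`, §4).

* `not_sawScalingLimit_of_not_eventualTight : ¬ EventualTight → ¬ SAW.SAWScalingLimit` — a refutation of
  the crux would refute the Lawler–Schramm–Werner conjecture AS TYPED (the summit conjunct
  `SAWScalingLimit`, hence every SAW route): WHY the crux resists cheap disproof. Via
  `exists_isTightMeasureSet_image_of_convergesInLawToSLE` (convergence in law of the critical `δℤ²` SAW
  curve classes to chordal SLE_κ ⇒ tightness of the pushed laws on an initial mesh interval: Ulam
  tightness of the limit on the Polish `CurveClass ℂ`, one Urysohn test function per scale, compact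
  containers for the meshes bounded away from `0`, a closed totally bounded diagonal intersection).
  The positive form `SAWScalingLimit → EventualTight` was proved by refuter cdisprove-0783 in
  `Cruxes/SubseqIdentification/Disproof.lean` §6; this file re-hosts that proof (verbatim up to
  namespaces) in the refuter-admissible negative form. Everything proved, standard axioms. [folklore]
-/

noncomputable section

open Literature.Probability.RandomPlanarGeometry Literature.Probability.RandomPlanarGeometry.SAW
  Literature.Probability.LatticeModels Literature.Probability MeasureTheory Filter Topology Set
open scoped NNReal ENNReal BoundedContinuousFunction

namespace Summit.CriticalPhenomena.SAWScalingLimit.Theorems.EventualTight.Negative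

open Summit.CriticalPhenomena.SAWScalingLimit.Theorems.SubseqIdentification.Negative
  (eventually_isProbabilityMeasure_law exists_isCompact_forall_curve_mem_zd)
open Summit.CriticalPhenomena.SAWScalingLimit.Theses.SAWRenewalTightness (EventualTight)

variable {κ : ℝ≥0} {D : DobrushinDomain} {a b : ℝ → Site 2}

/-- **TIGHTNESS IS NECESSARY (set form, fixed `δ₀`).** If the critical `δℤ²` SAW curve classes of
`(D; a_δ, b_δ)` (an endpoint approximation) converge in law to chordal SLE_κ, then for some
`δ₀ > 0` the pushed-forward laws `{(P_δ).map curve : δ ∈ (0, δ₀]}` form a tight set of measures —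
literally the clause of `EventualTight`. Ingredients: Ulam tightness of the limit law on the Polish
space `CurveClass ℂ`; one Urysohn test function per scale `1/(k+1)`; compact containers for the
meshes in `[Θ_{k+1}, δ₀]`; a closed, totally bounded diagonal intersection. [folklore] -/
theorem exists_isTightMeasureSet_image_of_convergesInLawToSLE (hab : IsEndpointApprox D a b)
    (h : ConvergesInLawToSLE κ D (fun δ (γ : DomainSAW D.carrier δ (a δ) (b δ)) => γ.curve)
      (fun δ => law D.carrier δ (a δ) (b δ))) :
    ∃ δ₀ : ℝ, 0 < δ₀ ∧ IsTightMeasureSet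
      ((fun δ => (law D.carrier δ (a δ) (b δ)).map (fun γ => γ.curve)) '' Set.Ioc 0 δ₀) := by
  classical
  obtain ⟨Γ, hΓ, -, hT⟩ := h
  haveI := isProbabilityMeasure_preWienerMeasure'
  set μ : Measure (CurveClass ℂ) := Process.preWienerMeasure.map Γ with hμ
  haveI hμP : IsProbabilityMeasure μ := Measure.isProbabilityMeasure_map hΓ.aemeasurable
  -- good meshes: probability laws and distinct endpoints, on a fixed interval `(0, δ₁)`
  have hgood : ∀ᶠ δ in 𝓝[>] (0 : ℝ),
      IsProbabilityMeasure (law D.carrier δ (a δ) (b δ)) ∧ a δ ≠ b δ := by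
    refine (eventually_isProbabilityMeasure_law hab).and ?_
    have hne : D.pt 0 ≠ D.pt 1 := fun h => absurd (D.pt_injective h) (by decide)
    obtain ⟨U, V, hU, hV, h0U, h1V, hUV⟩ := t2_separation hne
    filter_upwards [hab.tendsto_fst (hU.mem_nhds h0U), hab.tendsto_snd (hV.mem_nhds h1V)]
      with δ h0 h1 heq
    have h0' : meshPoint δ (b δ) ∈ U := by rw [← heq]; exact h0
    exact Set.disjoint_left.1 hUV h0' h1
  obtain ⟨δ₁, hδ₁, hδ₁sub⟩ := mem_nhdsGT_iff_exists_Ioo_subset.1 hgood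
  set δ₀ : ℝ := δ₁ / 2 with hδ₀
  have hδ₀pos : 0 < δ₀ := by rw [hδ₀]; exact half_pos hδ₁
  have hδ₀lt : δ₀ < δ₁ := by rw [hδ₀]; exact half_lt_self hδ₁
  have hgood' : ∀ δ ∈ Set.Ioc (0 : ℝ) δ₀,
      IsProbabilityMeasure (law D.carrier δ (a δ) (b δ)) ∧ a δ ≠ b δ :=
    fun δ hδ => hδ₁sub ⟨hδ.1, hδ.2.trans_lt hδ₀lt⟩
  refine ⟨δ₀, hδ₀pos, ?_⟩
  rw [isTightMeasureSet_iff_exists_isCompact_measure_compl_le]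
  intro ε hε
  rcases eq_or_ne ε ⊤ with rfl | hεtop
  · exact ⟨∅, isCompact_empty, fun _ _ => le_top⟩
  set e : ℝ := ε.toReal with he
  have he0 : 0 < e := ENNReal.toReal_pos hε.ne' hεtop
  -- per-level data: compact K_k (nonempty), threshold θ_k
  have hlevel : ∀ k : ℕ, ∃ K : Set (CurveClass ℂ), IsCompact K ∧ K.Nonempty ∧ ∃ θ : ℝ, 0 < θ ∧
      ∀ δ ∈ Set.Ioo (0 : ℝ) θ, IsProbabilityMeasure (law D.carrier δ (a δ) (b δ)) ∧
        law D.carrier δ (a δ) (b δ)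
            ((fun γ : DomainSAW D.carrier δ (a δ) (b δ) => γ.curve) ⁻¹'
              (Metric.thickening (1 / ((k : ℝ) + 1)) K)ᶜ) ≤ ENNReal.ofReal (e / 2 / 2 ^ k) := by
    intro k
    set ek : ℝ := e / 2 / 2 ^ k with hek_def
    have hek : 0 < ek := by positivity
    obtain ⟨K0, hK0c, hK0⟩ := (isTightMeasureSet_iff_exists_isCompact_measure_compl_le.1
      (isTightMeasureSet_singleton (μ := μ))) (ENNReal.ofReal (ek / 2))
      (ENNReal.ofReal_pos.2 (by positivity))
    have hμK0 : μ K0ᶜ ≤ ENNReal.ofReal (ek / 2) := hK0 μ rfl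
    set c₀ : CurveClass ℂ := CurveClass.mk (Curve.const 0)
    set K1 : Set (CurveClass ℂ) := insert c₀ K0 with hK1
    have hK1c : IsCompact K1 := hK0c.insert c₀
    have hK1ne : K1.Nonempty := ⟨c₀, Set.mem_insert _ _⟩
    have hμK1 : μ K1ᶜ ≤ ENNReal.ofReal (ek / 2) :=
      (measure_mono (Set.compl_subset_compl.2 (Set.subset_insert _ _))).trans hμK0
    have hη : (0 : ℝ) < 1 / ((k : ℝ) + 1) := by positivity
    obtain ⟨g, hg0, hg1, hgK, hgF⟩ := Summit.CriticalPhenomena.SAWScalingLimit.Theorems.ObservableToSLE.Negative.exists_urysohn_infDist K1 hη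
    have hlim : ∫ x, g x ∂μ < ek := by
      refine (Summit.CriticalPhenomena.SAWScalingLimit.Theorems.ObservableToSLE.Negative.integral_urysohn_le hK1c.isClosed hg1 hgK).trans_lt ?_
      rw [measureReal_def]
      have : (μ K1ᶜ).toReal ≤ ek / 2 := ENNReal.toReal_le_of_le_ofReal (by positivity) hμK1
      linarith
    have ht := hT g
    have hint_eq : ∫ ω, g (Γ ω) ∂Process.preWienerMeasure = ∫ x, g x ∂μ :=
      (integral_map hΓ.aemeasurable g.continuous.aestronglyMeasurable).symm
    rw [hint_eq] at ht
    have hev : ∀ᶠ δ in 𝓝[>] (0 : ℝ),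
        ∫ γ, g ((fun γ : DomainSAW D.carrier δ (a δ) (b δ) => γ.curve) γ)
          ∂law D.carrier δ (a δ) (b δ) < ek :=
      ht.eventually (Iio_mem_nhds hlim)
    obtain ⟨θ, hθ, hθsub⟩ := mem_nhdsGT_iff_exists_Ioo_subset.1 (hev.and hgood)
    refine ⟨K1, hK1c, hK1ne, θ, hθ, fun δ hδ => ?_⟩
    obtain ⟨hint, hg'⟩ := hθsub hδ
    refine ⟨hg'.1, ?_⟩
    haveI := hg'.1
    have hF : MeasurableSet (Metric.thickening (1 / ((k : ℝ) + 1)) K1)ᶜ :=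
      Metric.isOpen_thickening.measurableSet.compl
    have h1 : (law D.carrier δ (a δ) (b δ)).real
        ((fun γ : DomainSAW D.carrier δ (a δ) (b δ) => γ.curve) ⁻¹'
          (Metric.thickening (1 / ((k : ℝ) + 1)) K1)ᶜ) ≤
        ∫ γ, g ((fun γ : DomainSAW D.carrier δ (a δ) (b δ) => γ.curve) γ)
          ∂law D.carrier δ (a δ) (b δ) :=
      Summit.CriticalPhenomena.SAWScalingLimit.Theorems.ObservableToSLE.Negative.measureReal_preimage_le_integral (DomainSAW.measurable_of_top _) hF
        hg0 fun x hx => hgF x (by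
          by_contra h'
          exact hx ((Metric.mem_thickening_iff_infDist_lt hK1ne).2 (not_le.1 h')))
    calc law D.carrier δ (a δ) (b δ)
          ((fun γ : DomainSAW D.carrier δ (a δ) (b δ) => γ.curve) ⁻¹'
            (Metric.thickening (1 / ((k : ℝ) + 1)) K1)ᶜ)
        = ENNReal.ofReal ((law D.carrier δ (a δ) (b δ)).real
            ((fun γ : DomainSAW D.carrier δ (a δ) (b δ) => γ.curve) ⁻¹'
              (Metric.thickening (1 / ((k : ℝ) + 1)) K1)ᶜ)) :=
          (ENNReal.ofReal_toReal (measure_ne_top _ _)).symm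
      _ ≤ ENNReal.ofReal ek := ENNReal.ofReal_le_ofReal (h1.trans hint.le)
  choose K hKc hKne θ hθ hKθ using hlevel
  -- antitone positive thresholds `Θ k = min_{j ≤ k} θ j`
  set Θ : ℕ → ℝ := fun k => (Finset.range (k + 1)).inf' (Finset.nonempty_range_iff.2
    (Nat.succ_ne_zero k)) θ with hΘ
  have hΘle : ∀ k, Θ k ≤ θ k := fun k =>
    Finset.inf'_le _ (Finset.mem_range.2 (Nat.lt_succ_self k))
  have hΘpos : ∀ k, 0 < Θ k := fun k => (Finset.lt_inf'_iff _).2 fun j _ => hθ j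
  have hΘanti : ∀ k, Θ (k + 1) ≤ Θ k := fun k =>
    (Finset.le_inf'_iff _ _).2 fun j hj =>
      Finset.inf'_le _ (Finset.mem_range.2 ((Finset.mem_range.1 hj).trans (Nat.lt_succ_self _)))
  -- compact containers for meshes in `[Θ (k+1), δ₀]`
  have hC : ∀ k, ∃ C : Set (CurveClass ℂ), IsCompact C ∧ ∀ δ ∈ Set.Icc (Θ (k + 1)) δ₀,
      ∀ u v : Site 2, u ≠ v → ∀ γ : DomainSAW D.carrier δ u v, γ.curve ∈ C := fun k =>
    exists_isCompact_forall_curve_mem_zd D.isBounded (hΘpos (k + 1))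
  choose C hCc hCmem using hC
  set η : ℕ → ℝ := fun k => 1 / ((k : ℝ) + 1) with hη
  have hηpos : ∀ k, 0 < η k := fun k => by positivity
  set A : ℕ → Set (CurveClass ℂ) := fun k => Metric.cthickening (η k) (K k) ∪ C k with hA
  set Kf : Set (CurveClass ℂ) := ⋂ k, A k with hKf
  have hKf_closed : IsClosed Kf :=
    isClosed_iInter fun k => Metric.isClosed_cthickening.union (hCc k).isClosed
  have hKf_tb : TotallyBounded Kf := by
    refine Metric.totallyBounded_iff.2 fun r hr => ?_
    obtain ⟨k, hk⟩ := exists_nat_gt (3 / r)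
    have hηk : 3 * η k < r := by
      have h3 : 3 < r * k := by rwa [div_lt_iff₀ hr, mul_comm] at hk
      have hk0 : (0 : ℝ) < k := by
        by_contra h0
        have : (k : ℝ) ≤ 0 := not_lt.1 h0
        nlinarith
      show 3 * (1 / ((k : ℝ) + 1)) < r
      rw [mul_one_div, div_lt_iff₀ (by positivity)]
      nlinarith
    obtain ⟨t, htfin, htcov⟩ :=
      Metric.totallyBounded_iff.1 ((hKc k).union (hCc k)).totallyBounded (η k) (hηpos k)
    refine ⟨t, htfin, fun x hx => ?_⟩
    have hxA : x ∈ A k := Set.mem_iInter.1 hx k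
    rcases hxA with hx1 | hx2
    · have hx1' : x ∈ Metric.thickening (2 * η k) (K k) :=
        Metric.cthickening_subset_thickening' (by linarith [hηpos k]) (by linarith [hηpos k]) _ hx1
      obtain ⟨z, hz, hxz⟩ := Metric.mem_thickening_iff.1 hx1'
      obtain ⟨y, hy, hzy⟩ := Set.mem_iUnion₂.1 (htcov (Or.inl hz))
      refine Set.mem_iUnion₂.2 ⟨y, hy, ?_⟩
      rw [Metric.mem_ball] at hzy ⊢
      calc dist x y ≤ dist x z + dist z y := dist_triangle _ _ _
        _ < 2 * η k + η k := add_lt_add hxz hzy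
        _ = 3 * η k := by ring
        _ < r := hηk
    · obtain ⟨y, hy, hxy⟩ := Set.mem_iUnion₂.1 (htcov (Or.inr hx2))
      refine Set.mem_iUnion₂.2 ⟨y, hy, ?_⟩
      rw [Metric.mem_ball] at hxy ⊢
      have : η k < r := by linarith [hηpos k]
      exact hxy.trans this
  have hKf_compact : IsCompact Kf :=
    isCompact_iff_totallyBounded_isComplete.2 ⟨hKf_tb, hKf_closed.isComplete⟩
  refine ⟨Kf, hKf_compact, ?_⟩
  rintro ν ⟨δ, hδ, rfl⟩
  rw [Measure.map_apply (DomainSAW.measurable_of_top _) hKf_closed.isOpen_compl.measurableSet]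
  have hpre : (fun γ : DomainSAW D.carrier δ (a δ) (b δ) => γ.curve) ⁻¹' Kfᶜ =
      ⋃ k, (fun γ : DomainSAW D.carrier δ (a δ) (b δ) => γ.curve) ⁻¹' (A k)ᶜ := by
    simp only [hKf, Set.compl_iInter, Set.preimage_iUnion]
  rw [hpre]
  refine (measure_iUnion_le _).trans ?_
  have hbound : ∀ k, law D.carrier δ (a δ) (b δ)
      ((fun γ : DomainSAW D.carrier δ (a δ) (b δ) => γ.curve) ⁻¹' (A k)ᶜ) ≤
        ENNReal.ofReal (e / 2 / 2 ^ k) := by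
    intro k
    rcases lt_or_ge δ (Θ (k + 1)) with hlt | hle
    · have hδk : δ ∈ Set.Ioo 0 (θ k) := ⟨hδ.1, hlt.trans_le ((hΘanti k).trans (hΘle k))⟩
      refine (measure_mono ?_).trans (hKθ k δ hδk).2
      refine Set.preimage_mono (Set.compl_subset_compl.2 ?_)
      exact (Metric.thickening_subset_cthickening _ _).trans Set.subset_union_left
    · have hne : a δ ≠ b δ := (hgood' δ hδ).2
      have hempty : (fun γ : DomainSAW D.carrier δ (a δ) (b δ) => γ.curve) ⁻¹' (A k)ᶜ = ∅ :=
        Set.eq_empty_of_forall_notMem fun γ hγ => hγ (Or.inr (hCmem k δ ⟨hle, hδ.2⟩ _ _ hne γ))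
      rw [hempty, measure_empty]
      exact bot_le
  calc ∑' k, law D.carrier δ (a δ) (b δ)
          ((fun γ : DomainSAW D.carrier δ (a δ) (b δ) => γ.curve) ⁻¹' (A k)ᶜ)
        ≤ ∑' k, ENNReal.ofReal (e / 2 / 2 ^ k) := ENNReal.tsum_le_tsum hbound
    _ = ENNReal.ofReal (∑' k, e / 2 / 2 ^ k) :=
        (ENNReal.ofReal_tsum_of_nonneg (fun k => by positivity) (summable_geometric_two' e)).symm
    _ = ENNReal.ofReal e := by rw [tsum_geometric_two' e]
    _ = ε := ENNReal.ofReal_toReal hεtop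

/-- **`¬ EventualTight → ¬ SAWScalingLimit`**: the crux (stmt-CriticalPhenomena-1372) is a CONSEQUENCE of
the summit conjunct, so a refutation of eventual tightness refutes the Lawler–Schramm–Werner
conjecture as typed (every SAW route) — recorded for the negatives index. [folklore] -/
theorem not_sawScalingLimit_of_not_eventualTight (h : ¬ EventualTight) : ¬ SAW.SAWScalingLimit :=
  fun h' => h fun D a b hab => exists_isTightMeasureSet_image_of_convergesInLawToSLE hab (h' D a b hab)

end Summit.CriticalPhenomena.SAWScalingLimit.Theorems.EventualTight.Negative

end
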